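import Summits.Ventures.HodgeRepro2.T5SU11LegendreLaplaceHeine

/-!
# The Laplace–Heine asymptotic UNIFORMLY on `t ≥ t₀ > 0`: `√n · e^{−2nt} · P_n(cosh 2t) → 1/√(π(1 − e^{−4t}))`
uniformly on `[t₀, ∞)`, and on the group for `φ_{2n+2}(a_t)`

Row 393 (`T5SU11LegendreLaplaceHeine`) proved the pointwise limit by a three-block ε-argument on the Heine ratio
`T_n(z) = S_n(z)/a_n`, `z = e^{−4t}`. Here the same two bounds (`sum_le_heineSum_div`, `heineSum_div_le`) are run with
the cut `m = ⌊√n⌋` and every `z`-dependence replaced by its value at `z₀`: for `0 ≤ z ≤ z₀ < 1` and `n ≥ 1`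

  **`|T_n(z) − (1 − z)^{−1/2}| ≤ E_n(z₀) := (e^{1/√n} − 1)/√(1 − z₀) + 3 z₀^{⌊√n⌋}/(1 − z₀) + 2n z₀^{n/2+1}/(1 − z₀)`**
  (`abs_heineSum_div_sub_le`),

using the tail bound `Σ_{j≥m} a_j zʲ ≤ z₀^m/(1 − z₀)` (`tsum_sub_sum_le`), the ratio factor
`(1 + 1/(2(n−m)+1))^m ≤ e^{m/(2(n−m)+1)} ≤ e^{1/√n}` for `m = ⌊√n⌋` (`ratio_factor_le_exp`, `nat_sqrt_div_le`: the
denominator `2(n − √n) + 1 ≥ n` since `(√n − 1)² ≥ 0`) and `⌊√n⌋ ≤ n/2 + 1` (`nat_sqrt_le_half_add_one`). Since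
`E_n(z₀) → 0` (`tendsto_uniformErr`):

  **`T_n → (1 − z)^{−1/2}` uniformly on `[0, z₀]`**   (`tendstoUniformlyOn_heineSum_div`),

and with Stirling's `√n a_n → 1/√π` (row 391) and `T_n(z) ≤ (1 − z₀)^{−1/2} + E_n(z₀)`:

  **`√n e^{−2nt} P_n(cosh 2t) → 1/√(π(1 − e^{−4t}))` uniformly on `t ≥ t₀`**   (`tendstoUniformlyOn_laplace_heine`),
  **`√n e^{−2nt} φ_{2n+2}(a_t) → 1/√(π(1 − e^{−4t}))` uniformly on `t ≥ t₀`**   (`tendstoUniformlyOn_sph_laplace_heine`),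

with the explicit error `|√n e^{−2nt} P_n(cosh 2t) − 1/√(π(1 − e^{−4t}))| ≤ E'_n(z₀)` (`abs_sqrt_mul_sub_le`,
`E'_n = |√n a_n − 1/√π| ((1 − z₀)^{−1/2} + E_n) + E_n/√π`). Nothing is claimed about (N).

Blind lane: Mathlib + the HodgeRepro2 prefix only; no sorry; axioms ⊆ {propext, Classical.choice,
Quot.sound}.
-/

namespace Summit.Ventures.HodgeRepro2.T5SU11LegendreLaplaceHeineUniform

open Filter Topology Finset Set
open T5SU11Cartan T5SU11SphericalFunction T5SU11SphericalLegendreAll T5SU11SphericalAsymptotic T5SU11LegendreHeine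
  T5SU11LegendreCentralBinomial T5SU11LegendreHeineBounds T5SU11LegendreLaplaceHeine

/-! ### The three ingredients: the tail, the ratio factor, the cut `m = ⌊√n⌋` -/

/-- **The tail of the series**: `L(z) − Σ_{j<m} a_j zʲ ≤ z₀^m/(1 − z₀)` for `0 ≤ z ≤ z₀ < 1`. -/
theorem tsum_sub_sum_le {z₀ : ℝ} (hz₀ : z₀ < 1) {z : ℝ} (hz : z ∈ Icc 0 z₀) (m : ℕ) :
    (∑' j : ℕ, binomHalf j * z ^ j) - ∑ j ∈ range m, binomHalf j * z ^ j ≤ z₀ ^ m / (1 - z₀) := by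
  have hz0 : 0 ≤ z := hz.1
  have hzz : z ≤ z₀ := hz.2
  have hz₀0 : 0 ≤ z₀ := hz0.trans hzz
  have hz1 : z < 1 := lt_of_le_of_lt hzz hz₀
  have hsum := summable_binomHalf_mul_pow hz0 hz1
  rw [← hsum.sum_add_tsum_nat_add m, add_sub_cancel_left]
  have hgeom : Summable fun j : ℕ => z₀ ^ (j + m) := by
    simpa [pow_add] using (summable_geometric_of_lt_one hz₀0 hz₀).mul_right (z₀ ^ m)
  have hshift : Summable fun j : ℕ => binomHalf (j + m) * z ^ (j + m) := (summable_nat_add_iff m).mpr hsum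
  calc ∑' j : ℕ, binomHalf (j + m) * z ^ (j + m) ≤ ∑' j : ℕ, z₀ ^ (j + m) := by
        refine hshift.tsum_le_tsum (fun j => ?_) hgeom
        calc binomHalf (j + m) * z ^ (j + m) ≤ 1 * z₀ ^ (j + m) :=
              mul_le_mul (binomHalf_le_one _) (pow_le_pow_left₀ hz0 hzz _) (pow_nonneg hz0 _) zero_le_one
          _ = z₀ ^ (j + m) := one_mul _
    _ = z₀ ^ m / (1 - z₀) := by
        simp_rw [pow_add]
        rw [tsum_mul_right, tsum_geometric_of_lt_one hz₀0 hz₀, div_eq_mul_inv, mul_comm]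

/-- **The ratio factor**: `(1 + 1/(2(n−m)+1))^m ≤ e^{m/(2(n−m)+1)}`. -/
theorem ratio_factor_le_exp (n m : ℕ) :
    (1 + 1 / (2 * ((n - m : ℕ) : ℝ) + 1)) ^ m ≤ Real.exp ((m : ℝ) / (2 * ((n - m : ℕ) : ℝ) + 1)) := by
  rw [div_eq_mul_one_div (m : ℝ), Real.exp_nat_mul]
  refine pow_le_pow_left₀ (by positivity) ?_ m
  have := Real.add_one_le_exp (1 / (2 * ((n - m : ℕ) : ℝ) + 1))
  linarith

/-- **`⌊√n⌋ ≤ n/2 + 1`.** -/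
theorem nat_sqrt_le_half_add_one (n : ℕ) : Nat.sqrt n ≤ n / 2 + 1 := by
  have h := Nat.sqrt_le' n
  rcases Nat.lt_or_ge (Nat.sqrt n) 2 with h2 | h2
  · omega
  · have : 2 * Nat.sqrt n ≤ Nat.sqrt n ^ 2 := by nlinarith
    omega

/-- **`⌊√n⌋/(2(n − ⌊√n⌋) + 1) ≤ 1/√n`** for `n ≥ 1` (the denominator is `≥ n` since `(√n − 1)² ≥ 0`). -/
theorem nat_sqrt_div_le {n : ℕ} (hn : 1 ≤ n) :
    ((Nat.sqrt n : ℕ) : ℝ) / (2 * ((n - Nat.sqrt n : ℕ) : ℝ) + 1) ≤ 1 / Real.sqrt n := by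
  have hs : ((Nat.sqrt n : ℕ) : ℝ) ≤ Real.sqrt n := Real.nat_sqrt_le_real_sqrt
  have hsn : Nat.sqrt n ≤ n := Nat.sqrt_le_self n
  have hcast : ((n - Nat.sqrt n : ℕ) : ℝ) = (n : ℝ) - Nat.sqrt n := by rw [Nat.cast_sub hsn]
  rw [hcast]
  have hn' : (1 : ℝ) ≤ n := by exact_mod_cast hn
  have hsq : Real.sqrt n * Real.sqrt n = n := Real.mul_self_sqrt (by linarith)
  have hsqpos : 0 < Real.sqrt n := Real.sqrt_pos.mpr (by linarith)
  have hs0 : (0 : ℝ) ≤ Nat.sqrt n := Nat.cast_nonneg _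
  have hden : (n : ℝ) ≤ 2 * ((n : ℝ) - Nat.sqrt n) + 1 := by nlinarith [sq_nonneg (Real.sqrt n - 1)]
  rw [div_le_div_iff₀ (by linarith) hsqpos]
  calc ((Nat.sqrt n : ℕ) : ℝ) * Real.sqrt n ≤ Real.sqrt n * Real.sqrt n :=
        mul_le_mul_of_nonneg_right hs hsqpos.le
    _ = n := hsq
    _ ≤ 1 * (2 * ((n : ℝ) - Nat.sqrt n) + 1) := by linarith

/-! ### The uniform error and the uniform bound -/

/-- **The uniform error** `E_n(z₀) = (e^{1/√n} − 1)/√(1 − z₀) + 3 z₀^{⌊√n⌋}/(1 − z₀) + 2n z₀^{n/2+1}/(1 − z₀)`. -/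
noncomputable def uniformErr (z₀ : ℝ) (n : ℕ) : ℝ :=
  (Real.exp (1 / Real.sqrt n) - 1) * (1 / Real.sqrt (1 - z₀)) + 3 * z₀ ^ Nat.sqrt n / (1 - z₀)
    + 2 * (n : ℝ) * z₀ ^ (n / 2 + 1) / (1 - z₀)

/-- **`|T_n(z) − (1 − z)^{−1/2}| ≤ E_n(z₀)`** for `0 ≤ z ≤ z₀ < 1`, `n ≥ 1`. -/
theorem abs_heineSum_div_sub_le {z₀ : ℝ} (hz₀ : z₀ < 1) {z : ℝ} (hz : z ∈ Icc 0 z₀) {n : ℕ} (hn : 1 ≤ n) :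
    |heineSum z n / binomHalf n - 1 / Real.sqrt (1 - z)| ≤ uniformErr z₀ n := by
  set m := Nat.sqrt n with hm
  have hz0 : 0 ≤ z := hz.1
  have hzz : z ≤ z₀ := hz.2
  have hz₀0 : 0 ≤ z₀ := hz0.trans hzz
  have hz1 : z < 1 := lt_of_le_of_lt hzz hz₀
  have h1z : 0 < 1 - z := by linarith
  have h1z₀ : 0 < 1 - z₀ := by linarith
  have hsum := summable_binomHalf_mul_pow hz0 hz1
  have hL := tsum_binomHalf_mul_pow hz0 hz1
  have hmn : m ≤ n / 2 + 1 := nat_sqrt_le_half_add_one n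
  have hlow := sum_le_heineSum_div hz0 (z := z) (m := m) (n := n) (by omega)
  have hup := heineSum_div_le hz0 hz1 hn hmn
  have htail := tsum_sub_sum_le hz₀ hz m
  rw [hL] at htail
  have hfac : (1 + 1 / (2 * ((n - m : ℕ) : ℝ) + 1)) ^ m ≤ Real.exp (1 / Real.sqrt n) :=
    (ratio_factor_le_exp n m).trans (Real.exp_le_exp.mpr (nat_sqrt_div_le hn))
  have hpos0 : (0 : ℝ) ≤ 1 / (2 * ((n - m : ℕ) : ℝ) + 1) := by positivity
  have hfac1 : 1 ≤ (1 + 1 / (2 * ((n - m : ℕ) : ℝ) + 1)) ^ m := one_le_pow₀ (by linarith)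
  have hS0 : 0 ≤ ∑ j ∈ range m, binomHalf j * z ^ j :=
    Finset.sum_nonneg fun j _ => by have := binomHalf_pos j; positivity
  have hSL : ∑ j ∈ range m, binomHalf j * z ^ j ≤ 1 / Real.sqrt (1 - z) := by
    rw [← hL]
    exact hsum.sum_le_tsum _ fun j _ => by have := binomHalf_pos j; positivity
  have hLz : 1 / Real.sqrt (1 - z) ≤ 1 / Real.sqrt (1 - z₀) :=
    one_div_le_one_div_of_le (Real.sqrt_pos.mpr h1z₀) (Real.sqrt_le_sqrt (by linarith))
  have hL0 : 0 ≤ 1 / Real.sqrt (1 - z₀) := by positivity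
  have hA : z ^ m / (1 - z) ≤ z₀ ^ m / (1 - z₀) :=
    div_le_div₀ (pow_nonneg hz₀0 _) (pow_le_pow_left₀ hz0 hzz _) h1z₀ (by linarith)
  have hB : z ^ (n / 2 + 1) / (1 - z) ≤ z₀ ^ (n / 2 + 1) / (1 - z₀) :=
    div_le_div₀ (pow_nonneg hz₀0 _) (pow_le_pow_left₀ hz0 hzz _) h1z₀ (by linarith)
  have hA0 : 0 ≤ z₀ ^ m / (1 - z₀) := by positivity
  have hB0 : 0 ≤ z₀ ^ (n / 2 + 1) / (1 - z₀) := by positivity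
  have hE1 : 0 ≤ (Real.exp (1 / Real.sqrt n) - 1) * (1 / Real.sqrt (1 - z₀)) := by
    have : 1 ≤ Real.exp (1 / Real.sqrt n) := Real.one_le_exp (by positivity)
    exact mul_nonneg (by linarith) hL0
  -- the product term of the upper bound
  have hprod : (1 + 1 / (2 * ((n - m : ℕ) : ℝ) + 1)) ^ m * ∑ j ∈ range m, binomHalf j * z ^ j
      ≤ 1 / Real.sqrt (1 - z) + (Real.exp (1 / Real.sqrt n) - 1) * (1 / Real.sqrt (1 - z₀)) := by
    have e1 : (1 + 1 / (2 * ((n - m : ℕ) : ℝ) + 1)) ^ m * ∑ j ∈ range m, binomHalf j * z ^ j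
        ≤ Real.exp (1 / Real.sqrt n) * ∑ j ∈ range m, binomHalf j * z ^ j :=
      mul_le_mul_of_nonneg_right hfac hS0
    have e2 : (Real.exp (1 / Real.sqrt n) - 1) * ∑ j ∈ range m, binomHalf j * z ^ j
        ≤ (Real.exp (1 / Real.sqrt n) - 1) * (1 / Real.sqrt (1 - z₀)) :=
      mul_le_mul_of_nonneg_left (hSL.trans hLz) (by linarith)
    nlinarith
  unfold uniformErr
  rw [← hm, abs_le]
  have e2z : 2 * z ^ m / (1 - z) = 2 * (z ^ m / (1 - z)) := by ring
  have e2z' : 2 * (n : ℝ) * z ^ (n / 2 + 1) / (1 - z) = 2 * n * (z ^ (n / 2 + 1) / (1 - z)) := by ring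
  have e3 : 3 * z₀ ^ m / (1 - z₀) = 3 * (z₀ ^ m / (1 - z₀)) := by ring
  have e3' : 2 * (n : ℝ) * z₀ ^ (n / 2 + 1) / (1 - z₀) = 2 * n * (z₀ ^ (n / 2 + 1) / (1 - z₀)) := by ring
  rw [e2z, e2z'] at hup
  rw [e3, e3']
  have hn0 : (0 : ℝ) ≤ n := Nat.cast_nonneg n
  have hBn : 2 * (n : ℝ) * (z ^ (n / 2 + 1) / (1 - z)) ≤ 2 * n * (z₀ ^ (n / 2 + 1) / (1 - z₀)) :=
    mul_le_mul_of_nonneg_left hB (by positivity)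
  have hBn0 : 0 ≤ 2 * (n : ℝ) * (z₀ ^ (n / 2 + 1) / (1 - z₀)) := by positivity
  constructor
  · linarith
  · linarith

/-! ### The error tends to zero -/

/-- `⌊√n⌋ → ∞`. -/
theorem tendsto_nat_sqrt : Tendsto Nat.sqrt atTop atTop :=
  tendsto_atTop_atTop.mpr fun b => ⟨b * b, fun _ hn => Nat.le_sqrt.mpr hn⟩

/-- `e^{1/√n} − 1 → 0`. -/
theorem tendsto_exp_one_div_sqrt_sub_one :
    Tendsto (fun n : ℕ => Real.exp (1 / Real.sqrt n) - 1) atTop (𝓝 0) := by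
  have h1 : Tendsto (fun n : ℕ => 1 / Real.sqrt n) atTop (𝓝 0) := by
    have : Tendsto (fun n : ℕ => Real.sqrt (1 / (n : ℝ))) atTop (𝓝 (Real.sqrt 0)) :=
      (Real.continuous_sqrt.tendsto 0).comp tendsto_one_div_atTop_nhds_zero_nat
    rw [Real.sqrt_zero] at this
    refine this.congr fun n => ?_
    rw [one_div, Real.sqrt_inv, one_div]
  have h2 : Tendsto (fun n : ℕ => Real.exp (1 / Real.sqrt n)) atTop (𝓝 (Real.exp 0)) :=
    (Real.continuous_exp.tendsto 0).comp h1
  rw [Real.exp_zero] at h2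
  simpa using h2.sub_const 1

/-- **`E_n(z₀) → 0`** for `0 < z₀ < 1`. -/
theorem tendsto_uniformErr {z₀ : ℝ} (hz₀0 : 0 < z₀) (hz₀ : z₀ < 1) :
    Tendsto (uniformErr z₀) atTop (𝓝 0) := by
  have h1 : Tendsto (fun n : ℕ => (Real.exp (1 / Real.sqrt n) - 1) * (1 / Real.sqrt (1 - z₀))) atTop
      (𝓝 (0 * (1 / Real.sqrt (1 - z₀)))) := tendsto_exp_one_div_sqrt_sub_one.mul_const _
  have h2 : Tendsto (fun n : ℕ => 3 * z₀ ^ Nat.sqrt n / (1 - z₀)) atTop (𝓝 (3 * 0 / (1 - z₀))) :=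
    (((tendsto_pow_atTop_nhds_zero_of_lt_one hz₀0.le hz₀).comp tendsto_nat_sqrt).const_mul 3).div_const _
  have h3 : Tendsto (fun n : ℕ => 2 * (n : ℝ) * z₀ ^ (n / 2 + 1) / (1 - z₀)) atTop (𝓝 (2 * 0 * z₀ / (1 - z₀))) := by
    have := (((tendsto_mul_pow_div_two hz₀0 hz₀).const_mul 2).mul_const z₀).div_const (1 - z₀)
    refine this.congr fun n => ?_
    rw [pow_succ]
    ring
  have := (h1.add h2).add h3
  rw [show (0 : ℝ) * (1 / Real.sqrt (1 - z₀)) + 3 * 0 / (1 - z₀) + 2 * 0 * z₀ / (1 - z₀) = 0 by ring] at this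
  exact this

/-! ### Uniform convergence of the Heine ratio -/

/-- **`T_n(z) = S_n(z)/a_n → (1 − z)^{−1/2}` uniformly on `[0, z₀]`** for `0 < z₀ < 1`. -/
theorem tendstoUniformlyOn_heineSum_div {z₀ : ℝ} (hz₀0 : 0 < z₀) (hz₀ : z₀ < 1) :
    TendstoUniformlyOn (fun n z => heineSum z n / binomHalf n) (fun z => 1 / Real.sqrt (1 - z)) atTop
      (Icc 0 z₀) := by
  rw [Metric.tendstoUniformlyOn_iff]
  intro ε hε
  filter_upwards [(tendsto_uniformErr hz₀0 hz₀).eventually_lt_const hε, eventually_ge_atTop 1] with n hn hn1 z hz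
  rw [Real.dist_eq, abs_sub_comm]
  exact lt_of_le_of_lt (abs_heineSum_div_sub_le hz₀ hz hn1) hn

/-! ### The uniform Laplace–Heine asymptotic -/

/-- **The uniform error of the Laplace–Heine asymptotic**
`E'_n(z₀) = |√n a_n − 1/√π| ((1 − z₀)^{−1/2} + E_n(z₀)) + E_n(z₀)/√π`. -/
noncomputable def uniformErr' (z₀ : ℝ) (n : ℕ) : ℝ :=
  |Real.sqrt n * binomHalf n - 1 / Real.sqrt Real.pi| * (1 / Real.sqrt (1 - z₀) + uniformErr z₀ n)
    + uniformErr z₀ n / Real.sqrt Real.pi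

/-- **`|√n a_n T_n(z) − (1/√π)(1 − z)^{−1/2}| ≤ E'_n(z₀)`** for `0 ≤ z ≤ z₀ < 1`, `n ≥ 1`. -/
theorem abs_sqrt_mul_heineSum_sub_le {z₀ : ℝ} (hz₀ : z₀ < 1) {z : ℝ} (hz : z ∈ Icc 0 z₀) {n : ℕ} (hn : 1 ≤ n) :
    |Real.sqrt n * binomHalf n * (heineSum z n / binomHalf n)
        - 1 / Real.sqrt Real.pi * (1 / Real.sqrt (1 - z))| ≤ uniformErr' z₀ n := by
  have hE := abs_heineSum_div_sub_le hz₀ hz hn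
  have h1z₀ : 0 < 1 - z₀ := by linarith
  have hLz : 1 / Real.sqrt (1 - z) ≤ 1 / Real.sqrt (1 - z₀) :=
    one_div_le_one_div_of_le (Real.sqrt_pos.mpr h1z₀) (Real.sqrt_le_sqrt (by linarith [hz.2]))
  have hT : heineSum z n / binomHalf n ≤ 1 / Real.sqrt (1 - z₀) + uniformErr z₀ n := by
    have := (abs_le.mp hE).2
    linarith
  have hT0 : 0 ≤ heineSum z n / binomHalf n := by
    simpa using sum_le_heineSum_div hz.1 (z := z) (m := 0) (n := n) (by omega)
  have hπ : 0 < 1 / Real.sqrt Real.pi := by positivity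
  set A := Real.sqrt n * binomHalf n with hA
  set T := heineSum z n / binomHalf n with hT'
  set L := 1 / Real.sqrt (1 - z) with hL
  set c := 1 / Real.sqrt Real.pi with hc
  have e : A * T - c * L = (A - c) * T + c * (T - L) := by ring
  rw [uniformErr', e]
  calc |(A - c) * T + c * (T - L)| ≤ |(A - c) * T| + |c * (T - L)| := abs_add_le _ _
    _ = |A - c| * T + c * |T - L| := by rw [abs_mul, abs_mul, abs_of_nonneg hT0, abs_of_pos hπ]
    _ ≤ |A - c| * (1 / Real.sqrt (1 - z₀) + uniformErr z₀ n) + c * uniformErr z₀ n := by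
        gcongr
    _ = |A - c| * (1 / Real.sqrt (1 - z₀) + uniformErr z₀ n) + uniformErr z₀ n / Real.sqrt Real.pi := by
        rw [hc]; ring

/-- **`E'_n(z₀) → 0`** for `0 < z₀ < 1`. -/
theorem tendsto_uniformErr' {z₀ : ℝ} (hz₀0 : 0 < z₀) (hz₀ : z₀ < 1) :
    Tendsto (uniformErr' z₀) atTop (𝓝 0) := by
  have hE := tendsto_uniformErr hz₀0 hz₀
  have h1 : Tendsto (fun n : ℕ => |Real.sqrt n * binomHalf n - 1 / Real.sqrt Real.pi|) atTop (𝓝 0) := by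
    have := (tendsto_sqrt_mul_binomHalf.sub_const (1 / Real.sqrt Real.pi)).abs
    simpa using this
  have h2 : Tendsto (fun n : ℕ => 1 / Real.sqrt (1 - z₀) + uniformErr z₀ n) atTop
      (𝓝 (1 / Real.sqrt (1 - z₀) + 0)) := hE.const_add _
  have h3 := (h1.mul h2).add (hE.div_const (Real.sqrt Real.pi))
  rw [show (0 : ℝ) * (1 / Real.sqrt (1 - z₀) + 0) + 0 / Real.sqrt Real.pi = 0 by ring] at h3
  exact h3

/-- **`|√n e^{−2nt} P_n(cosh 2t) − 1/√(π(1 − e^{−4t}))| ≤ E'_n(e^{−4t₀})`** for `t ≥ t₀ > 0`, `n ≥ 1`. -/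
theorem abs_sqrt_mul_sub_le {t₀ : ℝ} (ht₀ : 0 < t₀) {t : ℝ} (ht : t₀ ≤ t) {n : ℕ} (hn : 1 ≤ n) :
    |Real.sqrt n * (Real.exp (-(2 * (n : ℝ)) * t) * legP n (Real.cosh (2 * t)))
        - 1 / Real.sqrt (Real.pi * (1 - Real.exp (-(4 * t))))| ≤ uniformErr' (Real.exp (-(4 * t₀))) n := by
  have hz₀ : Real.exp (-(4 * t₀)) < 1 := by
    have := Real.exp_lt_exp.mpr (show -(4 * t₀) < 0 by linarith)
    rwa [Real.exp_zero] at this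
  have hz : Real.exp (-(4 * t)) ∈ Icc 0 (Real.exp (-(4 * t₀))) :=
    ⟨(Real.exp_pos _).le, Real.exp_le_exp.mpr (by linarith)⟩
  have h := abs_sqrt_mul_heineSum_sub_le hz₀ hz hn
  have hlim : 1 / Real.sqrt Real.pi * (1 / Real.sqrt (1 - Real.exp (-(4 * t))))
      = 1 / Real.sqrt (Real.pi * (1 - Real.exp (-(4 * t)))) := by
    rw [Real.sqrt_mul Real.pi_pos.le, one_div_mul_one_div]
  rw [exp_neg_mul_legP_cosh_eq_heineSum, ← hlim]
  have ha := (binomHalf_pos n).ne'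
  rw [mul_assoc, mul_div_cancel₀ _ ha] at h
  exact h

/-- **THE LAPLACE–HEINE ASYMPTOTIC, UNIFORMLY ON `t ≥ t₀ > 0`**:
`√n · e^{−2nt} · P_n(cosh 2t) → 1/√(π(1 − e^{−4t}))` uniformly on `[t₀, ∞)`. -/
theorem tendstoUniformlyOn_laplace_heine {t₀ : ℝ} (ht₀ : 0 < t₀) :
    TendstoUniformlyOn (fun (n : ℕ) (t : ℝ) => Real.sqrt n * (Real.exp (-(2 * (n : ℝ)) * t) * legP n (Real.cosh (2 * t))))
      (fun t => 1 / Real.sqrt (Real.pi * (1 - Real.exp (-(4 * t))))) atTop (Ici t₀) := by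
  rw [Metric.tendstoUniformlyOn_iff]
  intro ε hε
  have hz₀0 : 0 < Real.exp (-(4 * t₀)) := Real.exp_pos _
  have hz₀ : Real.exp (-(4 * t₀)) < 1 := by
    have := Real.exp_lt_exp.mpr (show -(4 * t₀) < 0 by linarith)
    rwa [Real.exp_zero] at this
  filter_upwards [(tendsto_uniformErr' hz₀0 hz₀).eventually_lt_const hε, eventually_ge_atTop 1] with n hn hn1 t ht
  rw [Real.dist_eq, abs_sub_comm]
  exact lt_of_le_of_lt (abs_sqrt_mul_sub_le ht₀ ht hn1) hn

section measure

variable [MeasurableSpace Circle] [BorelSpace Circle]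

/-- **On the group, uniformly on `t ≥ t₀ > 0`**: `√n · e^{−2nt} · φ_{2n+2}(a_t) → 1/√(π(1 − e^{−4t}))` uniformly on
`[t₀, ∞)` — the sharp asymptotic of the spherical functions of even parameter, uniform away from the identity coset. -/
theorem tendstoUniformlyOn_sph_laplace_heine {t₀ : ℝ} (ht₀ : 0 < t₀) :
    TendstoUniformlyOn
      (fun (n : ℕ) (t : ℝ) => Real.sqrt n * (Real.exp (-(2 * (n : ℝ)) * t) * sph (2 * (n : ℝ) + 2) (hyp t)))
      (fun t => 1 / Real.sqrt (Real.pi * (1 - Real.exp (-(4 * t))))) atTop (Ici t₀) := by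
  simp only [sph_even_hyp]
  exact tendstoUniformlyOn_laplace_heine ht₀

/-- **The explicit uniform error on the group**: `|√n e^{−2nt} φ_{2n+2}(a_t) − 1/√(π(1 − e^{−4t}))| ≤ E'_n(e^{−4t₀})`
for `t ≥ t₀ > 0`, `n ≥ 1`. -/
theorem abs_sqrt_mul_sph_sub_le {t₀ : ℝ} (ht₀ : 0 < t₀) {t : ℝ} (ht : t₀ ≤ t) {n : ℕ} (hn : 1 ≤ n) :
    |Real.sqrt n * (Real.exp (-(2 * (n : ℝ)) * t) * sph (2 * (n : ℝ) + 2) (hyp t))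
        - 1 / Real.sqrt (Real.pi * (1 - Real.exp (-(4 * t))))| ≤ uniformErr' (Real.exp (-(4 * t₀))) n := by
  rw [sph_even_hyp]
  exact abs_sqrt_mul_sub_le ht₀ ht hn

end measure

end Summit.Ventures.HodgeRepro2.T5SU11LegendreLaplaceHeineUniform
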